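import Summits.CriticalPhenomena.CardyFormulaZ2.Theorems.CardyBoundaryCoulombGasStripClusterRatesTwoClusterUpperWindow

/-!
# Uniform two-sided bounds `c ≤ n·γ_k(n) ≤ C` for ALL widths, without assuming convergence

Support file for line `two-cluster-rate-is-stationary-gap` (crux `StripClusterRates`,
stmt-CriticalPhenomena-13878), lead c5. The window theorems of `Negative.RateWindow`, `…TwoClusterUpperWindow`
and `…TwoClusterLowerWindow` are statements about a LIMIT `L` of `n·γ_k(n)` — they presuppose that the sequence
converges (which is part of what the crux asserts). This file records the honest limit-free form — UNIFORM
bounds over every width `n ≥ 1` and every pair of rate functions as in the crux: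

* `nMul_rateOne_mem_uniform : log 2/3 ≤ n·γ₁(n) ≤ 16 log 2` (self-duality `γ₁(n) ≥ log 2/(n+2)`; RSW
  `γ₁(n) ≤ 16 log 2/n` from `γ₁(2j+1) ≤ 8 log 2/(j+1)` + `rateOne_antitone`);
* `nMul_rateTwo_mem_uniform : 2 log 2/3 ≤ n·γ₂(n) ≤ 384 log 2` (BK `γ₂ ≥ 2γ₁`; the band inequality
  `γ₂(n) ≤ 3γ₁(h)` for `n ≥ 3h+3` from `band_rateTwo_le_three_mul_of_le`, and `γ₂ ≤ 3 log 2` for the small widths).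
So both sequences `n·γ₁(n)`, `n·γ₂(n)` are bounded away from `0` and `∞` — Aizenman's theorem (Nucl. Phys. B 485
(1997), Thm 3) for one and two spanning clusters in transfer-matrix order, in its limit-free form; the crux asserts
that they converge, to `π/3` and `2π`.

References: [Aizenman1997] Thm 3; Bollobás–Riordan (2006) Ch. 3 [BollobasRiordan2006].
-/

noncomputable section

open MeasureTheory Filter Topology
open Literature.Probability.LatticeModels Literature.Probability.Percolation

namespace Summit.CriticalPhenomena.CardyFormulaZ2.Cruxes.StripClusterRates.TwoClusterRateIsStationaryGap

open Summit.CriticalPhenomena.CardyFormulaZ2.Theorems.StripClusterRates.Negative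

/-! ## §1 One cluster -/

/-- **RSW at every width**: `γ₁(n) ≤ 16 log 2/n` for every `n ≥ 1` (odd widths `2j+1`: `8 log 2/(j+1)` by
`rateOne_odd_width_le`; even widths by `rateOne_antitone`). [folklore] -/
theorem rateOne_le_width {γ₁ : ℕ → ℝ} (h₁ : ∀ n : ℕ, 1 ≤ n → Tendsto (rateSeqOne n) atTop (𝓝 (γ₁ n)))
    {n : ℕ} (hn : 1 ≤ n) : γ₁ n ≤ 16 * Real.log 2 / n := by
  set j : ℕ := (n - 1) / 2 with hj
  have hjn : 2 * j + 1 ≤ n := by omega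
  have hnj : n ≤ 2 * j + 2 := by omega
  have hodd := rateOne_odd_width_le (h₁ (2 * j + 1) (by omega))
  have hanti := rateOne_antitone hjn (h₁ (2 * j + 1) (by omega)) (h₁ n hn)
  have hl : 0 < Real.log 2 := Real.log_pos one_lt_two
  have hj1 : (0 : ℝ) < (j : ℝ) + 1 := by positivity
  have hn1 : (0 : ℝ) < (n : ℝ) := by exact_mod_cast hn
  have hcast : (n : ℝ) ≤ 2 * j + 2 := by exact_mod_cast hnj
  calc γ₁ n ≤ γ₁ (2 * j + 1) := hanti
    _ ≤ 8 * Real.log 2 / (j + 1) := hodd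
    _ ≤ 16 * Real.log 2 / n := by
        rw [div_le_div_iff₀ hj1 hn1]; nlinarith

/-- **Uniform one-cluster window**: `log 2/3 ≤ n·γ₁(n) ≤ 16 log 2` for EVERY `n ≥ 1`. [cite: Aizenman1997, Thm 3] -/
theorem nMul_rateOne_mem_uniform {γ₁ : ℕ → ℝ} (h₁ : ∀ n : ℕ, 1 ≤ n → Tendsto (rateSeqOne n) atTop (𝓝 (γ₁ n)))
    {n : ℕ} (hn : 1 ≤ n) : Real.log 2 / 3 ≤ (n : ℝ) * γ₁ n ∧ (n : ℝ) * γ₁ n ≤ 16 * Real.log 2 := by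
  have hl : 0 < Real.log 2 := Real.log_pos one_lt_two
  have hn' : (1 : ℝ) ≤ n := by exact_mod_cast hn
  constructor
  · have h := rateOne_ge (h₁ n hn)
    -- n · log 2/(n+2) ≥ log 2/3 for n ≥ 1
    have hkey : Real.log 2 / 3 ≤ (n : ℝ) * (Real.log 2 / (n + 2)) := by
      rw [mul_div_assoc', div_le_div_iff₀ (by norm_num) (by positivity)]
      nlinarith
    exact hkey.trans (mul_le_mul_of_nonneg_left h (by positivity))
  · have h := rateOne_le_width h₁ hn
    have hn0 : (0 : ℝ) < n := by exact_mod_cast hn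
    calc (n : ℝ) * γ₁ n ≤ (n : ℝ) * (16 * Real.log 2 / n) := mul_le_mul_of_nonneg_left h hn0.le
      _ = 16 * Real.log 2 := by field_simp

/-! ## §2 Two clusters -/

/-- **Uniform upper bound on the two-cluster rate**: `n·γ₂(n) ≤ 384 log 2` for EVERY `n ≥ 1` (widths `n ≥ 6`:
`γ₂(n) ≤ 3γ₁(h)` with `h = ⌊(n−3)/3⌋ ≥ 1`, `3h+3 ≤ n ≤ 3h+5`, and `γ₁(h) ≤ 16 log 2/h`, `n/h ≤ 8`; widths `n ≤ 5`:
`γ₂ ≤ 3 log 2`). [cite: Aizenman1997, Thm 3] -/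
theorem nMul_rateTwo_le_uniform {γ₁ γ₂ : ℕ → ℝ}
    (h₁ : ∀ n : ℕ, 1 ≤ n → Tendsto (rateSeqOne n) atTop (𝓝 (γ₁ n)))
    (h₂ : ∀ n : ℕ, 1 ≤ n → Tendsto (rateSeqTwo n) atTop (𝓝 (γ₂ n))) {n : ℕ} (hn : 1 ≤ n) :
    (n : ℝ) * γ₂ n ≤ 384 * Real.log 2 := by
  have hl : 0 < Real.log 2 := Real.log_pos one_lt_two
  rcases le_or_gt n 5 with hsmall | hbig
  · have h := rateTwo_le hn (h₂ n hn)
    have hn5 : (n : ℝ) ≤ 5 := by exact_mod_cast hsmall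
    calc (n : ℝ) * γ₂ n ≤ (n : ℝ) * (3 * Real.log 2) := mul_le_mul_of_nonneg_left h (by positivity)
      _ ≤ 384 * Real.log 2 := by nlinarith
  · set h : ℕ := (n - 3) / 3 with hh
    have hh1 : 1 ≤ h := by omega
    have hhn : 3 * h + 3 ≤ n := by omega
    have hnh : n ≤ 3 * h + 5 := by omega
    have hband := band_rateTwo_le_three_mul_of_le h₁ h₂ hh1 hhn
    have hγ₁ := rateOne_le_width h₁ hh1
    have hh1' : (0 : ℝ) < (h : ℝ) := by exact_mod_cast hh1
    have hcast : (n : ℝ) ≤ 3 * h + 5 := by exact_mod_cast hnh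
    calc (n : ℝ) * γ₂ n ≤ (n : ℝ) * (3 * (16 * Real.log 2 / h)) := by
          refine mul_le_mul_of_nonneg_left (hband.trans ?_) (by positivity)
          linarith
      _ = 48 * Real.log 2 * ((n : ℝ) / h) := by ring
      _ ≤ 48 * Real.log 2 * 8 := by
          refine mul_le_mul_of_nonneg_left ?_ (by positivity)
          rw [div_le_iff₀ hh1']
          have : (1 : ℝ) ≤ h := by exact_mod_cast hh1
          nlinarith
      _ = 384 * Real.log 2 := by ring

/-- **Uniform two-cluster window**: `2 log 2/3 ≤ n·γ₂(n) ≤ 384 log 2` for EVERY `n ≥ 1` (lower: BK `γ₂ ≥ 2γ₁` and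
`γ₁(n) ≥ log 2/(n+2)`). [cite: Aizenman1997, Thm 3] -/
theorem nMul_rateTwo_mem_uniform {γ₁ γ₂ : ℕ → ℝ}
    (h₁ : ∀ n : ℕ, 1 ≤ n → Tendsto (rateSeqOne n) atTop (𝓝 (γ₁ n)))
    (h₂ : ∀ n : ℕ, 1 ≤ n → Tendsto (rateSeqTwo n) atTop (𝓝 (γ₂ n))) {n : ℕ} (hn : 1 ≤ n) :
    2 * Real.log 2 / 3 ≤ (n : ℝ) * γ₂ n ∧ (n : ℝ) * γ₂ n ≤ 384 * Real.log 2 := by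
  refine ⟨?_, nMul_rateTwo_le_uniform h₁ h₂ hn⟩
  have hbk := rateTwo_ge_two_mul_rateOne hn (h₁ n hn) (h₂ n hn)
  have hlow := (nMul_rateOne_mem_uniform h₁ hn).1
  have hn0 : (0 : ℝ) ≤ n := by positivity
  nlinarith [mul_le_mul_of_nonneg_left hbk hn0]

/-- **Uniform windows for the crux's two rate functions** (registered sub-goal `uniform_strip_windows` of
stmt-CriticalPhenomena-13878, lead c5; the crux's events inlined): for every family of one-cluster rates `γ₁` and
two-cluster rates `γ₂` of bond percolation on `ℤ²` at `p = 1/2` and EVERY width `n ≥ 1`,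
`log 2/3 ≤ n·γ₁(n) ≤ 16 log 2` and `2 log 2/3 ≤ n·γ₂(n) ≤ 384 log 2` — boundedness away from `0` and `∞` in
transfer-matrix order, with no convergence assumed (Aizenman 1997, Thm 3, `n = 1, 2`). [cite: Aizenman1997, Thm 3] -/
theorem uniform_strip_windows : ∀ γ₁ γ₂ : ℕ → ℝ, (∀ n : ℕ, 1 ≤ n → Tendsto (fun m : ℕ ↦ -Real.log (crossingProb half m n) / (m : ℝ)) atTop (𝓝 (γ₁ n))) → (∀ n : ℕ, 1 ≤ n → Tendsto (fun m : ℕ ↦ -Real.log ((bondPercolation (zdGraph 2) half).real {ω | ∃ x₁ ∈ (leftSide m n : Set (Site 2)), ∃ y₁ ∈ (rightSide m n : Set (Site 2)), ∃ x₂ ∈ (leftSide m n : Set (Site 2)), ∃ y₂ ∈ (rightSide m n : Set (Site 2)), ω ∈ openConnIn (rectangle m n : Set (Site 2)) x₁ y₁ ∧ ω ∈ openConnIn (rectangle m n : Set (Site 2)) x₂ y₂ ∧ ω ∉ openConnIn (rectangle m n : Set (Site 2)) x₁ x₂}) / (m : ℝ)) atTop (𝓝 (γ₂ n))) → ∀ n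 : ℕ, 1 ≤ n → (Real.log 2 / 3 ≤ (n : ℝ) * γ₁ n ∧ (n : ℝ) * γ₁ n ≤ 16 * Real.log 2) ∧ (2 * Real.log 2 / 3 ≤ (n : ℝ) * γ₂ n ∧ (n : ℝ) * γ₂ n ≤ 384 * Real.log 2) :=
  fun _ _ h₁ h₂ _ hn => ⟨nMul_rateOne_mem_uniform h₁ hn, nMul_rateTwo_mem_uniform h₁ h₂ hn⟩

end Summit.CriticalPhenomena.CardyFormulaZ2.Cruxes.StripClusterRates.TwoClusterRateIsStationaryGap

end
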